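import Summits.BirchSwinnertonDyer.BirchSwinnertonDyer.Theorems.GenusKolyvaginAtTwoGenusPrimitiveSupplyAtTwoGenusComponentsTower
import Summits.BirchSwinnertonDyer.BirchSwinnertonDyer.Theorems.GenusKolyvaginAtTwoGenusPrimitiveSupplyAtTwoKolyvaginClassAtTwo
import Summits.BirchSwinnertonDyer.Rank1Residual.X11b.RingClassGalArtin

/-!
# Route `GenusKolyvaginAtTwo`, crux `GenusPrimitiveSupplyAtTwo` (stmt-BirchSwinnertonDyer-22136), line `genus-supply`:
# GALOIS DESCENT of `2`-power roots along `K[m] ⊆ K[n]`, and the (R2)-CHAIN — the certificate at level `n` is EXACTLY the exact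
# `2`-adic index of ONE genus Heegner point at its own level

Lead prover seat bsd-line-gk2-p1 (g3). Completes the algebraic skeleton of the cell's U-LEDGER §5 (b)/(R2) (the (R1)/(a) chain is
`…GenusComponentsTower.heegner_exists_two_zsmul_eq_derivedPoint_of_forall_levels`):
* §1 Galois descent of ELEMENTS along the tower: `x ∈ K[n]` fixed by `Gal(K[n]/K[m])` lies in `K[m]` (Galois correspondence for
  `K[n]/K`, x11b3's `exists_hom_ringClassGal_algEquiv` + lit2's `RingClassField.subfieldIn`);
* §2 descent of POINTS and of `2^k`-th ROOTS (no `2`-torsion in `E(K[n])`): `P′ ∈ 2^k E(K[n]) ⟺ P ∈ 2^k E(K[m])` for `P ∈ E(K[m])`;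
* §3 odd multipliers and `2`-power cancellation: `u·X ∈ 2^k A ⟺ X ∈ 2^k A` (`u` odd), `2^b X ∈ 2^{a+b} A ⟺ X ∈ 2^a A` (no `2`-torsion);
* §4 **the (R2)-chain**: for `n = m₀ t₀` with every `a_ℓ`, `ℓ ∣ t₀`, EXACTLY once even (`a_ℓ = 2·odd`, depth-one Kolyvagin primes off
  `m₀`) and all genus components other than `Y_{M₀}` deep at level `n`:
  `P(n) ∈ 2E(K[n]) ⟺ Y_{M₀}^{(m₀)} ∈ 2^c E(K[m₀])`, `c + #{ℓ∣t₀} = r + 1` — i.e. the crux's certificate at `n` is the statement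
  «the genus-character Heegner point of `χ_{M₀}` at its own level has `2`-adic index below `c`» (with `m₀ = ∏M₀`: `c = #M₀ + 1`),
  W. Zhang's exact-index statement at `p = 2` for the genus twist `E^{(m₀*)}/K`.
Helper (`--supports stmt-BirchSwinnertonDyer-22136`); BSD is not proved by any of this.
-/

set_option linter.dupNamespace false -- tree convention: `Summit.BirchSwinnertonDyer.BirchSwinnertonDyer.Theorems` (summit = sub-problem)

noncomputable section

open scoped Classical

namespace Summit.BirchSwinnertonDyer.BirchSwinnertonDyer.Theorems.GenusKoly

open Finset NumberField WeierstrassCurve Literature.NumberTheory.EllipticCurves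
  Literature.NumberTheory.EllipticCurves.ModularForms Summit.BirchSwinnertonDyer.Rank1Residual.X11b

/-! ## §1 Galois descent of elements along `K[m] ⊆ K[n]` -/

section Elements

variable {K : Type} [Field K] [NumberField K] {ι : K →+* ℂ}

/-- **An element of `K[n]` fixed by `Gal(K[n]/K[m])` lies in `K[m]`** (`K[n]/K` is Galois; the Galois correspondence
`fixedField (fixingSubgroup E) = E` for the intermediate field `E = K[n] ∩ K[m]`; x11b3's identification of `𝒢_n` with `Aut_K(K[n])`).
[cite: GrossLMS1991, §3 (p. 216)] [cite: Cox2013, §9.A] -/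
theorem heegner_coe_mem_ringClassField_of_forall_apply_eq (hK : IsImaginaryQuadratic K) {m n : ℕ} (hn : n ≠ 0)
    (x : ringClassField K ι n) (hx : ∀ g ∈ ringClassGalOver ι n m, g x = x) : (x : ℂ) ∈ ringClassField K ι m := by
  letI : Algebra K ℂ := ι.toAlgebra
  haveI := (finiteDimensional_and_isGalois_ringClassField hK ι hn).1
  haveI := (finiteDimensional_and_isGalois_ringClassField hK ι hn).2
  obtain ⟨τ, hτbij, hτ⟩ := RingClassTower.exists_hom_ringClassGal_algEquiv (K := K) ι n
  rw [← RingClassField.mem_subfieldIn_iff ι n m x, ← IsGalois.fixedField_fixingSubgroup (RingClassField.subfieldIn ι n m),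
    IntermediateField.mem_fixedField_iff]
  intro σ hσ
  obtain ⟨g, rfl⟩ := hτbij.2 σ
  rw [hτ]
  refine hx _ ?_
  refine (_root_.mem_fixingSubgroup_iff (M := ringClassField K ι n ≃ₐ[ℚ] ringClassField K ι n)).mpr fun z hz ↦ ?_
  have hz' : z ∈ RingClassField.subfieldIn ι n m := (RingClassField.mem_subfieldIn_iff ι n m z).mpr hz
  rw [IntermediateField.mem_fixingSubgroup_iff] at hσ
  have := hσ z hz'
  rw [hτ] at this
  rw [AlgEquiv.smul_def]
  exact this

end Elements

/-! ## §2 Descent of points and of `2^k`-th roots -/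

section Abstract

variable {W : WeierstrassCurve ℚ} {L : Type*} [Field L] [CharZero L] {S T : Subfield L}

/-- A point of `E(T)` whose coordinates lie in `S ≤ T` comes from `E(S)` (abstract subfields). [folklore] -/
theorem exists_map_inclusion_eq_of_coords (hle : S ≤ T) (P' : (W.baseChange T).toAffine.Point)
    (hP' : ∀ (x y : T) (h : (W.baseChange T).toAffine.Nonsingular x y), P' = .some x y h → (x : L) ∈ S ∧ (y : L) ∈ S) :
    ∃ P : (W.baseChange S).toAffine.Point, WeierstrassCurve.Affine.Point.map (W' := W) (Subfield.inclusion hle).toRatAlgHom P = P' := by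
  rcases P' with _ | ⟨x, y, hxy⟩
  · exact ⟨0, rfl⟩
  · obtain ⟨hx, hy⟩ := hP' x y hxy rfl
    set x₀ : S := ⟨(x : L), hx⟩ with hx₀
    set y₀ : S := ⟨(y : L), hy⟩ with hy₀
    have hix : (Subfield.inclusion hle).toRatAlgHom x₀ = x := Subtype.ext rfl
    have hiy : (Subfield.inclusion hle).toRatAlgHom y₀ = y := Subtype.ext rfl
    have hns : (W.baseChange S).toAffine.Nonsingular x₀ y₀ :=
      (Affine.baseChange_nonsingular W (Subfield.inclusion hle).toRatAlgHom.injective x₀ y₀).mp (by rw [hix, hiy]; exact hxy)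
    refine ⟨.some x₀ y₀ hns, ?_⟩
    rw [Affine.Point.map_some]
    simp only [hix, hiy]

end Abstract

section Heegner

variable {W : WeierstrassCurve ℚ} [NeZero (W.conductorNorm ℤ)] {K : Type} [Field K] [NumberField K]
  {Dt : ModularParametrizationData W (W.conductorNorm ℤ)} {β : ℤ} {ι : K →+* ℂ}

omit [NeZero (W.conductorNorm ℤ)] in
/-- **Descent of points**: a point of `E(K[n])` fixed by `Gal(K[n]/K[m])` comes from `E(K[m])`. [cite: GrossLMS1991, §3 (p. 216)] -/
theorem heegner_exists_map_inclusion_eq_of_forall_pointGalHom_eq (hK : IsImaginaryQuadratic K) {m n : ℕ} (hn : n ≠ 0)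
    (hle : ringClassField K ι m ≤ ringClassField K ι n) (P' : (W.baseChange (ringClassField K ι n)).toAffine.Point)
    (hP' : ∀ g ∈ ringClassGalOver ι n m, pointGalHom W (ringClassField K ι n) g P' = P') :
    ∃ P : (W.baseChange (ringClassField K ι m)).toAffine.Point,
      WeierstrassCurve.Affine.Point.map (W' := W) (Subfield.inclusion hle).toRatAlgHom P = P' := by
  refine exists_map_inclusion_eq_of_coords hle P' fun x y h hP ↦ ?_
  subst hP
  have hcoord : ∀ g ∈ ringClassGalOver ι n m, g x = x ∧ g y = y := fun g hg ↦ by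
    have h1 := hP' g hg
    rw [pointGalHom_apply, Affine.Point.map_some] at h1
    simpa only [Affine.Point.some.injEq, AlgEquiv.coe_toAlgHom] using h1
  exact ⟨heegner_coe_mem_ringClassField_of_forall_apply_eq hK hn x fun g hg ↦ (hcoord g hg).1,
    heegner_coe_mem_ringClassField_of_forall_apply_eq hK hn y fun g hg ↦ (hcoord g hg).2⟩

omit [NeZero (W.conductorNorm ℤ)] in
/-- **Descent of `2^k`-th roots**: on the crux's frame (`ρ̄_{E,2}` onto, odd `d_K`, Heegner hypothesis, `n ≠ 0`), a point of `E(K[m])`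
is `2^k`-divisible in `E(K[n])` (after reading it there) iff it is `2^k`-divisible in `E(K[m])`: a `2^k`-th root in `E(K[n])` is fixed by
`Gal(K[n]/K[m])` since `E(K[n])` has no `2`-torsion. [cite: GrossLMS1991, §4, Lemma 4.3] -/
theorem heegner_exists_pow_smul_eq_map_iff [W.IsElliptic] [W.IsGloballyMinimal] (hK : IsImaginaryQuadratic K)
    (hodd : Odd (NumberField.discr K)) (hH : SatisfiesHeegnerHypothesis (W.conductorNorm ℤ) K)
    (hsurj : W.HasSurjectiveModNGaloisRep ((2 : ℤ) ^ 1)) {m n : ℕ} (hn : n ≠ 0)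
    (hle : ringClassField K ι m ≤ ringClassField K ι n) (P : (W.baseChange (ringClassField K ι m)).toAffine.Point) (k : ℕ) :
    (∃ Q : (W.baseChange (ringClassField K ι n)).toAffine.Point,
        ((2 : ℤ) ^ k) • Q = WeierstrassCurve.Affine.Point.map (W' := W) (Subfield.inclusion hle).toRatAlgHom P) ↔
      ∃ Q₀ : (W.baseChange (ringClassField K ι m)).toAffine.Point, ((2 : ℤ) ^ k) • Q₀ = P := by
  constructor
  · rintro ⟨Q, hQ⟩
    have hfix : ∀ g ∈ ringClassGalOver ι n m, pointGalHom W (ringClassField K ι n) g Q = Q := fun g hg ↦ by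
      have h0 : ((2 : ℤ) ^ k) • (pointGalHom W (ringClassField K ι n) g Q - Q) = 0 := by
        rw [smul_sub, ← map_zsmul, hQ, pointGalHom_map_inclusion_of_mem_fixingSubgroup hle hg, sub_self]
      exact sub_eq_zero.mp (heegner_two_pow_torsion_free (ι := ι) hK hodd hH hsurj hn k _ h0)
    obtain ⟨Q₀, hQ₀⟩ := heegner_exists_map_inclusion_eq_of_forall_pointGalHom_eq (W := W) hK hn hle Q hfix
    refine ⟨Q₀, Affine.Point.map_injective (W' := W) (Subfield.inclusion hle).toRatAlgHom ?_⟩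
    rw [map_zsmul, hQ₀, hQ]
  · rintro ⟨Q₀, hQ₀⟩
    exact ⟨WeierstrassCurve.Affine.Point.map (W' := W) (Subfield.inclusion hle).toRatAlgHom Q₀, by rw [← map_zsmul, hQ₀]⟩

/-! ## §3 Odd multipliers and `2`-power cancellation -/

omit [NeZero (W.conductorNorm ℤ)] in
/-- `u·X ∈ 2^k A ⟺ X ∈ 2^k A` for `u` odd (Bézout), in any additive commutative group. [folklore] -/
theorem exists_pow_smul_eq_odd_smul_iff {A : Type*} [AddCommGroup A] {u : ℤ} (hu : Odd u) (X : A) (k : ℕ) :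
    (∃ Q : A, ((2 : ℤ) ^ k) • Q = u • X) ↔ ∃ Q : A, ((2 : ℤ) ^ k) • Q = X := by
  obtain ⟨w, hw⟩ := hu
  have hcop : IsCoprime ((2 : ℤ) ^ k) u := by
    refine IsCoprime.pow_left ⟨-w, 1, ?_⟩
    rw [hw]; ring
  constructor
  · rintro ⟨Q, hQ⟩
    obtain ⟨a, b, hab⟩ := hcop
    refine ⟨a • X + b • Q, ?_⟩
    have h1 : ((2 : ℤ) ^ k) • (a • X + b • Q) = (a * (2 : ℤ) ^ k) • X + b • (((2 : ℤ) ^ k) • Q) := by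
      rw [smul_add, smul_smul, mul_comm, smul_comm]
    rw [h1, hQ, smul_smul, ← add_smul, hab, one_smul]
  · rintro ⟨Q, hQ⟩
    exact ⟨u • Q, by rw [smul_comm, hQ]⟩

omit [NeZero (W.conductorNorm ℤ)] in
/-- `2^b X ∈ 2^{a+b} A ⟺ X ∈ 2^a A` when `A` has no `2`-torsion. [folklore] -/
theorem exists_pow_add_smul_eq_pow_smul_iff {A : Type*} [AddCommGroup A] (htors : ∀ Q : A, (2 : ℤ) • Q = 0 → Q = 0) (X : A)
    (a b : ℕ) : (∃ Q : A, ((2 : ℤ) ^ (a + b)) • Q = ((2 : ℤ) ^ b) • X) ↔ ∃ Q : A, ((2 : ℤ) ^ a) • Q = X := by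
  constructor
  · rintro ⟨Q, hQ⟩
    refine ⟨Q, ?_⟩
    have h0 : ((2 : ℤ) ^ b) • (((2 : ℤ) ^ a) • Q - X) = 0 := by
      rw [smul_sub, smul_smul, ← pow_add, add_comm, hQ, sub_self]
    exact sub_eq_zero.mp (eq_zero_of_two_pow_smul_eq_zero htors b _ h0)
  · rintro ⟨Q, hQ⟩
    exact ⟨Q, by rw [pow_add, mul_comm, mul_smul, hQ]⟩

omit [NeZero (W.conductorNorm ℤ)] in
/-- `∏ (2·odd) = 2^{#} · odd`. [folklore] -/
theorem prod_eq_two_pow_mul_odd (s : Finset ℕ) (a : ℕ → ℤ) (h : ∀ ℓ ∈ s, ∃ b : ℤ, a ℓ = 2 * b ∧ Odd b) :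
    ∃ u : ℤ, (∏ ℓ ∈ s, a ℓ) = (2 : ℤ) ^ s.card * u ∧ Odd u := by
  choose! b hb using h
  refine ⟨∏ ℓ ∈ s, b ℓ, ?_, Finset.prod_induction _ Odd (fun x y hx hy ↦ hx.mul hy) odd_one (fun ℓ hℓ ↦ (hb ℓ hℓ).2)⟩
  rw [Finset.prod_congr rfl (fun ℓ hℓ ↦ (hb ℓ hℓ).1), Finset.prod_mul_distrib, Finset.prod_const]

/-! ## §4 The (R2)-chain -/

/-- **THE (R2)-CHAIN: the certificate at level `n` is the exact `2`-adic index of ONE genus Heegner point at its own level.** Frame: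
`W` globally minimal with `ρ̄_{E,2}` onto, `K` imaginary quadratic with odd `d_K ≠ −3` and the Heegner hypothesis, `n` square-free of
Kolyvagin primes at `2`, a datum `d` of conductor `n`, radicals `θ` and an enumeration `G` of `𝒢_n`, an exceptional index `M₀ ⊆ {ℓ∣n}`
all OTHER components of which are `2^{r+1}`-deep at level `n` (`r = #{ℓ∣n}`); and for `M₀` a level `m₀` with `m₀ t₀ = n`, a point
`y₀ ∈ E(K[m₀])` over `x(m₀)`, radicals `θ′` and an enumeration `Gm₀` at level `m₀`, every `a_ℓ` (`ℓ ∣ t₀`) EXACTLY once even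
(`a_ℓ = 2·odd`: depth-one primes off `m₀`), and `c` with `c + #{ℓ∣t₀} = r + 1`. THEN
  `P(n) ∈ 2E(K[n]) ⟺ Y_{M₀}^{(m₀)} ∈ 2^c E(K[m₀])`.
With `m₀ = ∏M₀` (`c = #M₀ + 1`): the Kolyvagin level `n` certifies the crux iff the genus Heegner point of `χ_{M₀}` has `2`-adic index
`≤ #M₀` in `E(K[m₀])` — U-LEDGER (R2) as a theorem about points. [cite: GrossLMS1991, §3 (3.5), Prop. 3.7 (1), §4 (4.1), Lemma 4.3]
[cite: McCallumLMS1991, §5] -/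
theorem heegner_exists_two_zsmul_eq_derivedPoint_iff_genusComponent_of_level [W.IsElliptic] [W.IsGloballyMinimal]
    (hK : IsImaginaryQuadratic K) (hodd : Odd (NumberField.discr K)) (h3 : NumberField.discr K ≠ -3)
    (hH : SatisfiesHeegnerHypothesis (W.conductorNorm ℤ) K) (hsurj : W.HasSurjectiveModNGaloisRep ((2 : ℤ) ^ 1))
    {n : ℕ} (hn : Squarefree n) (hKoly : ∀ ℓ ∈ n.primeFactors, Zhang2014.IsKolyvaginPrime (W.conductorNorm ℤ) W K 2 ℓ)
    (d : KolyvaginHeegnerData Dt β ι n) {θ : ℕ → ringClassField K ι n}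
    (hθ : ∀ ℓ ∈ n.primeFactors, θ ℓ ^ 2 = algebraMap ℚ (ringClassField K ι n) ((-1 : ℚ) ^ (ℓ / 2) * ℓ))
    (G : Finset (ringClassField K ι n ≃ₐ[ℚ] ringClassField K ι n)) (hG : ∀ g, g ∈ G ↔ g ∈ ringClassGal ι n)
    {M₀ : Finset ℕ} (hM₀ : M₀ ∈ n.primeFactors.powerset)
    (hdeep : ∀ M ∈ n.primeFactors.powerset, M ≠ M₀ → ∃ Q : (W.baseChange (ringClassField K ι n)).toAffine.Point,
      ((2 : ℤ) ^ (n.primeFactors.card + 1)) • Q =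
        ∑ g ∈ G, (∏ ℓ ∈ M, (if g (θ ℓ) = θ ℓ then (1 : ℤ) else -1)) • pointGalHom W (ringClassField K ι n) g d.y)
    {m₀ t₀ : ℕ} (hmt : m₀ * t₀ = n) (hdepth : ∀ ℓ ∈ t₀.primeFactors, ∃ b : ℤ, W.frobeniusTrace ℓ = 2 * b ∧ Odd b)
    {c : ℕ} (hc : c + t₀.primeFactors.card = n.primeFactors.card + 1)
    {y₀ : (W.baseChange (ringClassField K ι m₀)).toAffine.Point}
    (hy₀ : WeierstrassCurve.Affine.Point.map (W' := W) (ringClassField K ι m₀).subtype.toRatAlgHom y₀ =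
      heegnerPointComplexOfConductor Dt (NumberField.discr K) β m₀)
    {θ' : ℕ → ringClassField K ι m₀} (hθ' : ∀ ℓ ∈ M₀, θ' ℓ ^ 2 = algebraMap ℚ (ringClassField K ι m₀) ((-1 : ℚ) ^ (ℓ / 2) * ℓ))
    (Gm₀ : Finset (ringClassField K ι m₀ ≃ₐ[ℚ] ringClassField K ι m₀)) (hGm₀ : ∀ s, s ∈ Gm₀ ↔ s ∈ ringClassGal ι m₀) :
    (∃ Q : (W.baseChange (ringClassField K ι n)).toAffine.Point, (2 : ℤ) • Q = d.derivedPoint) ↔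
      ∃ R : (W.baseChange (ringClassField K ι m₀)).toAffine.Point, ((2 : ℤ) ^ c) • R =
        ∑ s ∈ Gm₀, (∏ ℓ ∈ M₀, (if s (θ' ℓ) = θ' ℓ then (1 : ℤ) else -1)) • pointGalHom W (ringClassField K ι m₀) s y₀ := by
  have hn0 : n ≠ 0 := hn.ne_zero
  have hD : NumberField.discr K < -4 := discr_lt_neg_four_of_odd hK hodd h3
  have hinert : ∀ q ∈ n.primeFactors, (Ideal.span {(q : 𝓞 K)}).IsPrime := fun q hq ↦ (hKoly q hq).2.2.2.2.1
  have hN : ∀ q ∈ n.primeFactors, ¬ q ∣ W.conductorNorm ℤ := fun q hq ↦ (hKoly q hq).2.1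
  have htors := heegner_two_torsion_free (ι := ι) hK hodd hH hsurj hn0
  have hle : ringClassField K ι m₀ ≤ ringClassField K ι n := ringClassField_mono hK ι (Dvd.intro t₀ hmt) hn0
  -- the certificate ⟺ the `M₀`-component at level `n` is not `2^{r+1}`-deep
  rw [heegner_exists_two_zsmul_eq_derivedPoint_iff_genusComponent hK hodd h3 hH hsurj hn hKoly d hθ G hG hM₀ hdeep]
  -- the `M₀`-component at level `n` is `A(t₀)·(Y^{(m₀)})′`, `A(t₀) = 2^{#t₀}·u`, `u` odd
  rw [heegner_genusComponent_eq_prod_frobeniusTrace_smul_map hK hD hH hn hinert hN d hmt hy₀ hle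
    (fun ℓ hℓ ↦ hθ ℓ (Finset.mem_powerset.mp hM₀ hℓ)) hθ' G hG Gm₀ hGm₀]
  obtain ⟨u, hu, huodd⟩ := prod_eq_two_pow_mul_odd t₀.primeFactors W.frobeniusTrace hdepth
  rw [hu, ← hc, mul_smul, ← map_zsmul, exists_pow_add_smul_eq_pow_smul_iff htors, map_zsmul, exists_pow_smul_eq_odd_smul_iff huodd,
    heegner_exists_pow_smul_eq_map_iff hK hodd hH hsurj hn0 hle]

end Heegner

end Summit.BirchSwinnertonDyer.BirchSwinnertonDyer.Theorems.GenusKoly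

end
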